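import Literature.NumberTheory.LFunctions.RiemannXiProofs
import HarnessLib

/-!
# Lagarias' averaged and differenced `ξ`-functions `A_{h,θ}`, `B_{h,θ}` (Lagarias 2005, §2) — definitions

LABEL (line 1): RH-FREE objects. This module contains DEFINITIONS ONLY (plus unfolding / symmetry
lemmas proved from `riemannXi_one_sub` and `riemannXi_conj_holds`); no statement about the location
of zeros is asserted here. bears_on: LADDER-RH B-C/B-P (COLUMN 6 DBR). WHAT THIS IS NOT: typing the
objects of a printed paper is transcription, not progress toward RH; nothing here bears on the truth
of RH.

Source: J. C. Lagarias, *Zero spacing distributions for differenced L-functions*, Acta Arith. 120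
(2005) 159–184 = arXiv:math/0601653 (held, materialised; locators `pNNNN:Lnn` refer to the
materialised arXiv text), **§2** (p0005:L70–115, p0005:L220–243, p0005:L370–399, p0006:L1–23) and
the counting conventions of **§3** (p0007:L72–73) and of Remark (1) after Lemma 2.2 (p0005:L245–259).

With `ξ = riemannXi` (`ξ(s) = ½ s(s−1) π^{−s/2} Γ(s/2) ζ(s)`, the paper's normalisation, p0005:L3–7)
and a real parameter `h`:

* `E_h(s) := ξ(s + h)` (`diffXiE h`), `E_{h,θ}(s) := e^{iθ} ξ(s + h)` (`diffXiErot h θ`)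
  (p0005:L387–388, p0006:L5);
* `A_h(s) := ½ (ξ(s+h) + ξ(s−h))` (`diffXiA h`), `B_h(s) := −(1/2i)(ξ(s+h) − ξ(s−h))`
  (`diffXiB h`; we write the constant `−1/(2i)` as `i/2`) (p0005:L72–80);
* `A_{h,θ} := (cos θ) A_h + (sin θ) B_h` (`diffXiArot h θ`),
  `B_{h,θ} := (−sin θ) A_h + (cos θ) B_h` (`diffXiBrot h θ`) (p0006:L9–19);
* the `s`-variable conjugate reflection `E♯(s) := conj E(1 − s̄)` (`critReflect E`, p0005:L229) and
  the decomposition `E = A − iB`, `A := ½(E + E♯)`, `B := −(1/2i)(E − E♯)` of Lemma 2.2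
  (`critRePart E`, `critImPart E`, p0005:L236–238), so that `A_h = critRePart (E_h)` etc.
  (`diffXiA_eq_critRePart`, from `ξ(s − h) = conj ξ(1 − s̄ + h)`, p0005:L392–399);
* the counting vocabulary used by Theorems 2.1/3.1/4.1/5.1/5.2: ordinates of critical-line zeros
  (`critZeroOrdinates F`), "all zeros on the critical line" (`AllZerosOnCriticalLine F`), "all zeros
  simple" (`AllZerosSimple F`), the number of critical-line zeros with ordinate in a set, counted
  with multiplicity (`critZeroCountOn F S`), interlacing (`CritZerosInterlace F G`, the printed
  numbering condition `γ_n(A) ≤ γ_n(B) ≤ γ_{n+1}(A)` of Remark (1), p0005:L245–259, rendered as the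
  equivalent enumeration-free condition "on every half-open height interval the two zero counts
  differ by at most one"), and `N(T, F)` = number of zeros with `|Im s| ≤ T` (`stripZeroCount F T`,
  p0007:L72–73).

Design: the de Branges `z`-variable (`s = ½ − iz`) versions live in
`Literature.Analysis.DeBrangesSpaces` (`sharp`, `IsHermiteBiehler`); Lemma 2.1 (1) is the tree's
named fact `lagarias2005_lemma_2_1` (PROVED, `lagarias2005_lemma_2_1_holds`). The names avoid
`lagariasE`/`lagariasA` (reserved for Lagarias' 2006 structure function `E_ξ = ξ(½−iz) + ξ′(½−iz)`,
`SuzukiWeilHilbertSpaceDefs.lean`). This is a DEFS-ONLY module shared by the two statement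
modules of the source (cell rh-crit/dbl, typers t4 and t5): deliberately NOT here are the theorems
of §§2–3 (Lemma 2.2, Theorems 2.1, 3.1 — `LagariasDifferencedXi.lean`) and of §§4–6 (Theorem 4.1,
Lemma 4.1, Lemma 5.1, Theorems 5.1, 5.2, Lemma 6.1 — `LagariasDifferencedXiSpacings.lean`), which
import this file.

## References
* [Lagarias2005] J. C. Lagarias, Acta Arith. 120 (2005) 159–184 = arXiv:math/0601653, §2–§3.
-/

noncomputable section

open Complex Set

namespace Literature.NumberTheory.LFunctions

/-! ## The `s`-variable reflection and the `A`/`B` decomposition (Lemma 2.2 set-up) -/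

/-- The `s`-variable conjugate reflection `E♯(s) := conj E(1 − s̄)` (de Branges' involution
`E♯(z) = conj E(z̄)` transported by `s = ½ − iz`). [cite: Lagarias2005, §2 p.5 (before Lemma 2.2)] -/
def critReflect (E : ℂ → ℂ) (s : ℂ) : ℂ :=
  (starRingEnd ℂ) (E (1 - (starRingEnd ℂ) s))

/-- Unfolding of `critReflect`. [cite: Lagarias2005, §2 p.5] -/
@[simp] theorem critReflect_apply (E : ℂ → ℂ) (s : ℂ) :
    critReflect E s = (starRingEnd ℂ) (E (1 - (starRingEnd ℂ) s)) := rfl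

/-- `♯` (in the `s`-variable) is an involution. [cite: Lagarias2005, §2 p.5] -/
@[simp] theorem critReflect_critReflect (E : ℂ → ℂ) : critReflect (critReflect E) = E := by
  funext s
  simp [critReflect]

/-- On the critical line `E♯(½ + it) = conj E(½ + it)`. [cite: Lagarias2005, §2 p.5] -/
theorem critReflect_critical (E : ℂ → ℂ) (t : ℝ) :
    critReflect E (1 / 2 + t * I) = (starRingEnd ℂ) (E (1 / 2 + t * I)) := by
  simp only [critReflect, map_add, map_mul, Complex.conj_ofReal, Complex.conj_I, map_div₀, map_one,
    map_ofNat]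
  congr 2
  ring

/-- `A(s) := ½ (E(s) + conj E(1 − s̄))`, the "real part" of the decomposition `E = A − iB` of
Lemma 2.2. [cite: Lagarias2005, Lemma 2.2 (statement), p.5] -/
def critRePart (E : ℂ → ℂ) (s : ℂ) : ℂ :=
  (E s + critReflect E s) / 2

/-- `B(s) := −(1/2i) (E(s) − conj E(1 − s̄))` (`−1/(2i) = i/2`), the "imaginary part" of the
decomposition `E = A − iB` of Lemma 2.2. [cite: Lagarias2005, Lemma 2.2 (statement), p.5] -/
def critImPart (E : ℂ → ℂ) (s : ℂ) : ℂ :=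
  I * (E s - critReflect E s) / 2

/-- `E = A − iB`. [cite: Lagarias2005, Lemma 2.2 (statement), p.5] -/
theorem critRePart_sub_I_mul_critImPart (E : ℂ → ℂ) (s : ℂ) :
    critRePart E s - I * critImPart E s = E s := by
  simp only [critRePart, critImPart]
  have hI : I * I = -1 := Complex.I_mul_I
  linear_combination (-(E s - critReflect E s) / 2) * hI

/-- On the critical line `A(½ + it) = Re E(½ + it)`; in particular `A` is real there.
[cite: Lagarias2005, Lemma 2.2 (statement), p.5] -/
theorem critRePart_critical (E : ℂ → ℂ) (t : ℝ) :
    critRePart E (1 / 2 + t * I) = ((E (1 / 2 + t * I)).re : ℂ) := by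
  rw [critRePart, critReflect_critical, Complex.add_conj]
  push_cast
  ring

/-- On the critical line `B(½ + it) = −Im E(½ + it)`; in particular `B` is real there.
[cite: Lagarias2005, Lemma 2.2 (statement), p.5] -/
theorem critImPart_critical (E : ℂ → ℂ) (t : ℝ) :
    critImPart E (1 / 2 + t * I) = ((-(E (1 / 2 + t * I)).im : ℝ) : ℂ) := by
  rw [critImPart, critReflect_critical, Complex.sub_conj]
  have hI : I * I = -1 := Complex.I_mul_I
  push_cast
  linear_combination ((E (1 / 2 + t * I)).im : ℂ) * hI

/-- The symmetry `A(½ − α + it) = conj A(½ + α + it)` ((2.6a), p0005:L271–273): `A♯ = A`.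
[cite: Lagarias2005, proof of Lemma 2.2, (2.6a) p.5] -/
theorem critReflect_critRePart (E : ℂ → ℂ) : critReflect (critRePart E) = critRePart E := by
  funext s
  have h2 : (starRingEnd ℂ) (2 : ℂ) = 2 := map_ofNat _ 2
  simp only [critRePart, critReflect, map_add, map_div₀, map_sub, map_one, Complex.conj_conj,
    sub_sub_cancel, h2]
  ring

/-- The symmetry `B(½ − α + it) = conj B(½ + α + it)` (p0005:L275–276): `B♯ = B`.
[cite: Lagarias2005, proof of Lemma 2.2, (2.6a) p.5] -/
theorem critReflect_critImPart (E : ℂ → ℂ) : critReflect (critImPart E) = critImPart E := by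
  funext s
  have h2 : (starRingEnd ℂ) (2 : ℂ) = 2 := map_ofNat _ 2
  simp only [critImPart, critReflect, map_mul, map_div₀, map_sub, map_one, Complex.conj_conj,
    Complex.conj_I, sub_sub_cancel, h2]
  ring

/-- `e^{iθ} = cos θ + i sin θ` with real `cos θ`, `sin θ` (Euler). [folklore] -/
private theorem exp_ofReal_mul_I_eq (θ : ℝ) :
    Complex.exp (θ * I) = (Real.cos θ : ℂ) + (Real.sin θ : ℂ) * I := by
  rw [Complex.exp_mul_I, Complex.ofReal_cos, Complex.ofReal_sin]

/-- `conj e^{iθ} = cos θ − i sin θ` for real `θ`. [folklore] -/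
private theorem conj_exp_ofReal_mul_I_eq (θ : ℝ) :
    (starRingEnd ℂ) (Complex.exp (θ * I)) = (Real.cos θ : ℂ) - (Real.sin θ : ℂ) * I := by
  rw [exp_ofReal_mul_I_eq]
  simp only [map_add, map_mul, Complex.conj_ofReal, Complex.conj_I]
  ring

/-- Rotation: for `E_θ := e^{iθ} E` one has `A_θ = (cos θ) A + (sin θ) B` (p0005:L373–379).
[cite: Lagarias2005, §2 p.5 (after Lemma 2.2)] -/
theorem critRePart_rotate (E : ℂ → ℂ) (θ : ℝ) (s : ℂ) :
    critRePart (fun w ↦ Complex.exp (θ * I) * E w) s =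
      (Real.cos θ : ℂ) * critRePart E s + (Real.sin θ : ℂ) * critImPart E s := by
  simp only [critRePart, critImPart, critReflect, map_mul]
  rw [conj_exp_ofReal_mul_I_eq, exp_ofReal_mul_I_eq]
  ring

/-- Rotation: for `E_θ := e^{iθ} E` one has `B_θ = (−sin θ) A + (cos θ) B` (p0005:L381–383).
[cite: Lagarias2005, §2 p.5 (after Lemma 2.2)] -/
theorem critImPart_rotate (E : ℂ → ℂ) (θ : ℝ) (s : ℂ) :
    critImPart (fun w ↦ Complex.exp (θ * I) * E w) s =
      -(Real.sin θ : ℂ) * critRePart E s + (Real.cos θ : ℂ) * critImPart E s := by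
  simp only [critRePart, critImPart, critReflect, map_mul]
  rw [conj_exp_ofReal_mul_I_eq, exp_ofReal_mul_I_eq]
  have hI : I * I = -1 := Complex.I_mul_I
  linear_combination ((Real.sin θ : ℂ) * (E s + (starRingEnd ℂ) (E (1 - (starRingEnd ℂ) s))) / 2) * hI

/-! ## Lagarias' family `E_h`, `E_{h,θ}`, `A_h`, `B_h`, `A_{h,θ}`, `B_{h,θ}` -/

/-- The shifted `ξ`-function `E_h(s) := ξ(s + h)` (`h` real). In the de Branges variable
`z` (`s = ½ − iz`) this is `E_h(z) = ξ(½ + h − iz)` of Lemma 6.1, a structure function for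
`h ≥ ½` (`lagarias2005_lemma_2_1_holds`, `lagarias2005_lemma_2_1.structureFunction`).
[cite: Lagarias2005, §2 p.5 (E_h(s) = ξ(s+h))] -/
def diffXiE (h : ℝ) (s : ℂ) : ℂ :=
  riemannXi (s + h)

/-- The rotated shifted `ξ`-function `E_{h,θ}(s) := e^{iθ} E_h(s) = e^{iθ} ξ(s + h)`.
[cite: Lagarias2005, §2 p.6 (E_{h,θ})] -/
def diffXiErot (h θ : ℝ) (s : ℂ) : ℂ :=
  Complex.exp (θ * I) * riemannXi (s + h)

/-- The **averaged `ξ`-function** `A_h(s) := ½ (ξ(s + h) + ξ(s − h))`.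
[cite: Lagarias2005, §2 p.5 (definition of A_h)] -/
def diffXiA (h : ℝ) (s : ℂ) : ℂ :=
  (riemannXi (s + h) + riemannXi (s - h)) / 2

/-- The **differenced `ξ`-function** `B_h(s) := −(1/2i) (ξ(s + h) − ξ(s − h))`; the constant
`−1/(2i)` is written `i/2`. (The abstract prints `B_h` with the opposite sign; §2's definition, used
throughout the paper and satisfying `E_h = A_h − i B_h`, is the one typed.)
[cite: Lagarias2005, §2 p.5 (definition of B_h)] -/
def diffXiB (h : ℝ) (s : ℂ) : ℂ :=
  I * (riemannXi (s + h) - riemannXi (s - h)) / 2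

/-- `A_{h,θ}(s) := (cos θ) A_h(s) + (sin θ) B_h(s)`. [cite: Lagarias2005, §2 p.6 (definition of A_{h,θ})] -/
def diffXiArot (h θ : ℝ) (s : ℂ) : ℂ :=
  (Real.cos θ : ℂ) * diffXiA h s + (Real.sin θ : ℂ) * diffXiB h s

/-- `B_{h,θ}(s) := (−sin θ) A_h(s) + (cos θ) B_h(s)`. [cite: Lagarias2005, §2 p.6 (definition of B_{h,θ})] -/
def diffXiBrot (h θ : ℝ) (s : ℂ) : ℂ :=
  -(Real.sin θ : ℂ) * diffXiA h s + (Real.cos θ : ℂ) * diffXiB h s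

/-- Unfolding of `diffXiE`. [cite: Lagarias2005, §2 p.5] -/
theorem diffXiE_apply (h : ℝ) (s : ℂ) : diffXiE h s = riemannXi (s + h) := rfl

/-- Unfolding of `diffXiErot`; `E_{h,θ} = e^{iθ} E_h`. [cite: Lagarias2005, §2 p.6] -/
theorem diffXiErot_apply (h θ : ℝ) (s : ℂ) :
    diffXiErot h θ s = Complex.exp (θ * I) * diffXiE h s := rfl

/-- Unfolding of `diffXiA`. [cite: Lagarias2005, §2 p.5] -/
theorem diffXiA_apply (h : ℝ) (s : ℂ) :
    diffXiA h s = (riemannXi (s + h) + riemannXi (s - h)) / 2 := rfl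

/-- Unfolding of `diffXiB`. [cite: Lagarias2005, §2 p.5] -/
theorem diffXiB_apply (h : ℝ) (s : ℂ) :
    diffXiB h s = I * (riemannXi (s + h) - riemannXi (s - h)) / 2 := rfl

/-- Unfolding of `diffXiArot`. [cite: Lagarias2005, §2 p.6] -/
theorem diffXiArot_apply (h θ : ℝ) (s : ℂ) :
    diffXiArot h θ s = (Real.cos θ : ℂ) * diffXiA h s + (Real.sin θ : ℂ) * diffXiB h s := rfl

/-- Unfolding of `diffXiBrot`. [cite: Lagarias2005, §2 p.6] -/
theorem diffXiBrot_apply (h θ : ℝ) (s : ℂ) :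
    diffXiBrot h θ s = -(Real.sin θ : ℂ) * diffXiA h s + (Real.cos θ : ℂ) * diffXiB h s := rfl

/-- `E_h = A_h − i B_h` (p0005:L388). [cite: Lagarias2005, §2 p.5] -/
theorem diffXiE_eq_diffXiA_sub (h : ℝ) (s : ℂ) : diffXiE h s = diffXiA h s - I * diffXiB h s := by
  simp only [diffXiE, diffXiA, diffXiB]
  have hI : I * I = -1 := Complex.I_mul_I
  linear_combination ((riemannXi (s + h) - riemannXi (s - h)) / 2) * hI

/-- `E_{h,θ} = A_{h,θ} − i B_{h,θ}` (p0005:L375). [cite: Lagarias2005, §2 p.5–6] -/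
theorem diffXiErot_eq_diffXiArot_sub (h θ : ℝ) (s : ℂ) :
    diffXiErot h θ s = diffXiArot h θ s - I * diffXiBrot h θ s := by
  rw [diffXiErot, ← diffXiE_apply, diffXiE_eq_diffXiA_sub, diffXiArot, diffXiBrot,
    exp_ofReal_mul_I_eq]
  have hI : I * I = -1 := Complex.I_mul_I
  linear_combination (-(Real.sin θ : ℂ) * diffXiB h s) * hI

/-- `A_{h,0} = A_h` (p0006:L21–23). [cite: Lagarias2005, §2 p.6] -/
@[simp] theorem diffXiArot_zero (h : ℝ) : diffXiArot h 0 = diffXiA h := by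
  funext s; simp [diffXiArot]

/-- `B_{h,0} = B_h` (p0006:L21–23). [cite: Lagarias2005, §2 p.6] -/
@[simp] theorem diffXiBrot_zero (h : ℝ) : diffXiBrot h 0 = diffXiB h := by
  funext s; simp [diffXiBrot]

/-- `A_0 = ξ` (p0005:L108). [cite: Lagarias2005, §2 p.5] -/
@[simp] theorem diffXiA_zero (s : ℂ) : diffXiA 0 s = riemannXi s := by
  simp [diffXiA]

/-- `B_0 = 0`. [cite: Lagarias2005, §2 p.5] -/
@[simp] theorem diffXiB_zero (s : ℂ) : diffXiB 0 s = 0 := by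
  simp [diffXiB]

/-- `A_{−h} = A_h` (p0005:L109). [cite: Lagarias2005, §2 p.5] -/
theorem diffXiA_neg (h : ℝ) (s : ℂ) : diffXiA (-h) s = diffXiA h s := by
  simp only [diffXiA, Complex.ofReal_neg, ← sub_eq_add_neg, sub_neg_eq_add]
  ring

/-- `B_{−h} = −B_h` (p0005:L110). [cite: Lagarias2005, §2 p.5] -/
theorem diffXiB_neg (h : ℝ) (s : ℂ) : diffXiB (-h) s = -diffXiB h s := by
  simp only [diffXiB, Complex.ofReal_neg, ← sub_eq_add_neg, sub_neg_eq_add]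
  ring

/-- `B_{h,θ} = A_{h,θ+π/2}` (p0005:L385). [cite: Lagarias2005, §2 p.5] -/
theorem diffXiBrot_eq_diffXiArot_add_pi_div_two (h θ : ℝ) (s : ℂ) :
    diffXiBrot h θ s = diffXiArot h (θ + Real.pi / 2) s := by
  simp [diffXiBrot, diffXiArot, Real.cos_add_pi_div_two, Real.sin_add_pi_div_two]

/-- The reflection identity `ξ(s − h) = conj ξ(1 − s̄ + h)` behind `A_h = ½(ξ(s+h) + conj ξ(1−s̄+h))`
(p0005:L392–399: "Here we used `ξ(s̄) = conj ξ(s)` and the functional equation `ξ(s) = ξ(1−s)`").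
[cite: Lagarias2005, §2 p.5–6] -/
theorem critReflect_diffXiE (h : ℝ) (s : ℂ) : critReflect (diffXiE h) s = riemannXi (s - h) := by
  rw [critReflect_apply, diffXiE_apply, ← riemannXi_conj_holds, ← riemannXi_one_sub]
  congr 1
  simp only [map_add, map_sub, map_one, Complex.conj_conj, Complex.conj_ofReal]
  ring

/-- `A_h = critRePart E_h`, i.e. `A_h(s) = ½(ξ(s+h) + conj ξ(1 − s̄ + h))` (p0005:L392).
[cite: Lagarias2005, §2 p.5] -/
theorem diffXiA_eq_critRePart (h : ℝ) (s : ℂ) : diffXiA h s = critRePart (diffXiE h) s := by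
  rw [critRePart, critReflect_diffXiE, diffXiE_apply, diffXiA]

/-- `B_h = critImPart E_h`, i.e. `B_h(s) = −(1/2i)(ξ(s+h) − conj ξ(1 − s̄ + h))` (p0005:L397).
[cite: Lagarias2005, §2 p.5] -/
theorem diffXiB_eq_critImPart (h : ℝ) (s : ℂ) : diffXiB h s = critImPart (diffXiE h) s := by
  rw [critImPart, critReflect_diffXiE, diffXiE_apply, diffXiB]

/-- `A_{h,θ} = critRePart E_{h,θ}` (the decomposition `E_{h,θ} = A_{h,θ} − iB_{h,θ}` is the one of
Lemma 2.2 applied to `E_{h,θ}`). [cite: Lagarias2005, §2 p.6] -/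
theorem diffXiArot_eq_critRePart (h θ : ℝ) (s : ℂ) :
    diffXiArot h θ s = critRePart (diffXiErot h θ) s := by
  have e : diffXiErot h θ = fun w ↦ Complex.exp (θ * I) * diffXiE h w := rfl
  rw [e, critRePart_rotate, ← diffXiA_eq_critRePart, ← diffXiB_eq_critImPart, diffXiArot]

/-- `B_{h,θ} = critImPart E_{h,θ}`. [cite: Lagarias2005, §2 p.6] -/
theorem diffXiBrot_eq_critImPart (h θ : ℝ) (s : ℂ) :
    diffXiBrot h θ s = critImPart (diffXiErot h θ) s := by
  have e : diffXiErot h θ = fun w ↦ Complex.exp (θ * I) * diffXiE h w := rfl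
  rw [e, critImPart_rotate, ← diffXiA_eq_critRePart, ← diffXiB_eq_critImPart, diffXiBrot]

/-- On the critical line `A_h(½ + it) = Re ξ(½ + h + it)` (p0005:L99). [cite: Lagarias2005, §2 p.5] -/
theorem diffXiA_critical (h t : ℝ) :
    diffXiA h (1 / 2 + t * I) = ((riemannXi (1 / 2 + t * I + h)).re : ℂ) := by
  rw [diffXiA_eq_critRePart, critRePart_critical, diffXiE_apply]

/-- On the critical line `B_h(½ + it) = −Im ξ(½ + h + it)` (p0005:L105). [cite: Lagarias2005, §2 p.5] -/
theorem diffXiB_critical (h t : ℝ) :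
    diffXiB h (1 / 2 + t * I) = ((-(riemannXi (1 / 2 + t * I + h)).im : ℝ) : ℂ) := by
  rw [diffXiB_eq_critImPart, critImPart_critical, diffXiE_apply]

/-- `A_{h,θ}` is real on the critical line. [cite: Lagarias2005, §2 p.5–6] -/
theorem im_diffXiArot_critical (h θ t : ℝ) : (diffXiArot h θ (1 / 2 + t * I)).im = 0 := by
  rw [diffXiArot, diffXiA_critical, diffXiB_critical]
  simp

/-- `B_{h,θ}` is real on the critical line. [cite: Lagarias2005, §2 p.5–6] -/
theorem im_diffXiBrot_critical (h θ t : ℝ) : (diffXiBrot h θ (1 / 2 + t * I)).im = 0 := by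
  rw [diffXiBrot, diffXiA_critical, diffXiB_critical]
  simp

/-- The extra symmetry `A_h(s̄) = conj A_h(s)` (from `ξ` real on the real axis, p0005:L112–114).
[cite: Lagarias2005, §2 p.5] -/
theorem diffXiA_conj (h : ℝ) (s : ℂ) :
    diffXiA h ((starRingEnd ℂ) s) = (starRingEnd ℂ) (diffXiA h s) := by
  simp only [diffXiA, map_div₀, map_add, map_ofNat]
  rw [← riemannXi_conj_holds, ← riemannXi_conj_holds]
  simp [Complex.conj_ofReal]

/-- `E_h` is entire. [cite: Lagarias2005, §2 p.5] -/
theorem differentiable_diffXiE (h : ℝ) : Differentiable ℂ (diffXiE h) :=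
  differentiable_riemannXi.comp (differentiable_id.add (differentiable_const _))

/-- `E_{h,θ}` is entire. [cite: Lagarias2005, §2 p.6] -/
theorem differentiable_diffXiErot (h θ : ℝ) : Differentiable ℂ (diffXiErot h θ) :=
  (differentiable_const _).mul (differentiable_diffXiE h)

/-- `A_h` is entire. [cite: Lagarias2005, §2 p.5] -/
theorem differentiable_diffXiA (h : ℝ) : Differentiable ℂ (diffXiA h) :=
  ((differentiable_riemannXi.comp (differentiable_id.add (differentiable_const _))).add
    (differentiable_riemannXi.comp (differentiable_id.sub (differentiable_const _)))).div_const 2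

/-- `B_h` is entire. [cite: Lagarias2005, §2 p.5] -/
theorem differentiable_diffXiB (h : ℝ) : Differentiable ℂ (diffXiB h) :=
  ((differentiable_const _).mul
    ((differentiable_riemannXi.comp (differentiable_id.add (differentiable_const _))).sub
      (differentiable_riemannXi.comp (differentiable_id.sub (differentiable_const _))))).div_const 2

/-- `A_{h,θ}` is entire. [cite: Lagarias2005, §2 p.6] -/
theorem differentiable_diffXiArot (h θ : ℝ) : Differentiable ℂ (diffXiArot h θ) :=
  ((differentiable_const _).mul (differentiable_diffXiA h)).add
    ((differentiable_const _).mul (differentiable_diffXiB h))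

/-- `B_{h,θ}` is entire. [cite: Lagarias2005, §2 p.6] -/
theorem differentiable_diffXiBrot (h θ : ℝ) : Differentiable ℂ (diffXiBrot h θ) :=
  ((differentiable_const _).mul (differentiable_diffXiA h)).add
    ((differentiable_const _).mul (differentiable_diffXiB h))

/-! ## Counting vocabulary for zeros on the critical line (§2 Remark (1), §3) -/

/-- The ordinates of the zeros of `F` on the critical line: `{t ∈ ℝ : F(½ + it) = 0}` (the
`γ_n(A)`, `γ_n(B)` of Remark (1) after Lemma 2.2 and of §3 range over this set).
[cite: Lagarias2005, §2 Remark (1) p.5; §3 p.7] -/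
def critZeroOrdinates (F : ℂ → ℂ) : Set ℝ :=
  {t : ℝ | F (1 / 2 + t * I) = 0}

/-- Membership in `critZeroOrdinates`. [cite: Lagarias2005, §2 Remark (1) p.5] -/
@[simp] theorem mem_critZeroOrdinates (F : ℂ → ℂ) (t : ℝ) :
    t ∈ critZeroOrdinates F ↔ F (1 / 2 + t * I) = 0 := Iff.rfl

/-- "All zeros of `F` lie on the critical line `Re s = ½`" (conclusion of Lemma 2.2 and of
Theorems 2.1/5.1). [cite: Lagarias2005, Lemma 2.2 / Theorem 2.1 (statements) pp.5–6] -/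
def AllZerosOnCriticalLine (F : ℂ → ℂ) : Prop :=
  ∀ s : ℂ, F s = 0 → s.re = 1 / 2

/-- "All zeros of `F` are simple" (for an entire `F`: `F(s) = 0 ⟹ F′(s) ≠ 0`), conclusion of
Theorems 2.1/5.1. [cite: Lagarias2005, Theorem 2.1 (statement) p.6] -/
def AllZerosSimple (F : ℂ → ℂ) : Prop :=
  ∀ s : ℂ, F s = 0 → deriv F s ≠ 0

/-- The number of zeros of `F` on the critical segment `{½ + it : t ∈ S}`, counted with
multiplicity (`analyticOrderNatAt`; a `finsum`, so `0` by convention if infinitely many — for a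
not-identically-zero entire `F` and bounded `S` the support is finite).
[cite: Lagarias2005, §2 Remark (1) p.5 ("counting zeros with multiplicity")] -/
def critZeroCountOn (F : ℂ → ℂ) (S : Set ℝ) : ℕ :=
  ∑ᶠ t ∈ critZeroOrdinates F ∩ S, analyticOrderNatAt F (1 / 2 + t * I)

/-- **Interlacing of critical-line zeros** (Remark (1) after Lemma 2.2: a numbering of the zeros
of the two functions by increasing ordinate, with multiplicity, such that
`γ_n(A) ≤ γ_n(B) ≤ γ_{n+1}(A)` for all `n`). Typed in the equivalent enumeration-free form: on every
half-open height interval `(t₁, t₂]` the numbers of zeros (with multiplicity) of `F` and of `G`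
differ by at most one. (From a numbering, the `F`-indices in `(t₁,t₂]` form a block `[p,q]` and
the `G`-indices lie between `[p, q−1]` and `[p−1, q]`; conversely the interval condition produces
the numbering greedily.) [cite: Lagarias2005, §2 Remark (1) p.5] -/
def CritZerosInterlace (F G : ℂ → ℂ) : Prop :=
  ∀ t₁ t₂ : ℝ, t₁ < t₂ →
    (critZeroCountOn F (Ioc t₁ t₂) : ℤ) - critZeroCountOn G (Ioc t₁ t₂) ≤ 1 ∧
      (critZeroCountOn G (Ioc t₁ t₂) : ℤ) - critZeroCountOn F (Ioc t₁ t₂) ≤ 1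

/-- `CritZerosInterlace` is symmetric. [cite: Lagarias2005, §2 Remark (1) p.5] -/
theorem CritZerosInterlace.symm {F G : ℂ → ℂ} (hFG : CritZerosInterlace F G) :
    CritZerosInterlace G F :=
  fun t₁ t₂ ht ↦ ⟨(hFG t₁ t₂ ht).2, (hFG t₁ t₂ ht).1⟩

/-- `N(T, F)`: the number of zeros of `F` with `|Im s| ≤ T`, counted with multiplicity
(`analyticOrderNatAt`; a `finsum`, `0` by convention when the set of such zeros is infinite).
[cite: Lagarias2005, §3 p.7 ("Let N(T, F) count the number of zeros of F(s) having |Im(s)| ≤ T")] -/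
def stripZeroCount (F : ℂ → ℂ) (T : ℝ) : ℕ :=
  ∑ᶠ s ∈ {s : ℂ | F s = 0 ∧ |s.im| ≤ T}, analyticOrderNatAt F s

end Literature.NumberTheory.LFunctions
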